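import Summits.Langlands.Langlands.Theorems.SqrtFiveQuarticCoversBorelThreeDivisionPolynomial

/-!
# Route `SqrtFiveQuarticCovers` (crux `RefinedLocusModular`, stmt-Langlands-17833): the moduli
# interpretation of `X₀(3)` for framed curves — a Borel mod-`3` framing gives a `K`-point of `X₀(3)`
# over `j(E)`, in the shape of the record's MODEL binders

`Theorems/SqrtFiveQuarticCoversBorelThreeDivisionPolynomial.lean` (p798920) turned the `b3`-binder of
the route's cruxes (an upper-triangular framing `ρ̄₃` of `E[3]`) into a `K`-rational root `x₀` of the
`3`-division polynomial `Ψ₃(E ⊗ K)`.  This file finishes the genus-`0` moduli interpretation: from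
such a root, the classical hauptmodul `t` of `X₀(3)` with

  `j(E) · t = (t + 27)(t + 3)³`, i.e. `c₄³ · t = (t + 27)(t + 3)³ · Δ`, `t ≠ 0`,

is `K`-RATIONAL and EXPLICIT: `t = Δ / υ(x₀)²` with `υ(x) = 4x³ + b₂x² + 2b₄x + b₆ = (2y + a₁x + a₃)²`
and `τ(x) = 6x² + b₂x + b₄`.  The engine is a pair of **flex identities**, valid over every
commutative ring for every root `x₀` of `Ψ₃` (explicit integer cofactors, `linear_combination`):

* `Δ_eq_of_eval_Ψ₃_eq_zero` :      `Δ = τ³ − 27 υ²`;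
* `c₄_mul_eq_of_eval_Ψ₃_eq_zero` : `c₄ · υ² = τ (τ³ − 24 υ²)`.

(They say that `E`, moved by the `u = 1` isomorphism `(x, y) ↦ (x − x₀, y − y₀ − (τ/g)(x − x₀))`,
`g = 2y₀ + a₁x₀ + a₃`, to the Deuring form `y² + (τ/g)xy + g·y = x³` with its flex at the origin, has
the SAME `c₄, Δ`: `c₄ = A₁(A₁³ − 24A₃)`, `Δ = A₃³(A₁³ − 27A₃)` with `A₁ = τ/g`, `A₃ = g`, `g² = υ`; and
`t + 27 = A₁³/A₃ = τ³/υ²` is the `X₁(3) = X₀(3)` coordinate, `j = (t+27)(t+3)³/t`.)  Consequences: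

* `exists_X0_three_hauptmodul_of_eval_Ψ₃_eq_zero` — over a field, `Ψ₃(x₀) = 0` and `Δ ≠ 0` give
  `t` with `c₄³ · t = (t + 27)(t + 3)³ · Δ` (and `υ(x₀) ≠ 0`);
* `exists_X0_three_hauptmodul_of_borelThree_framing` — for `E / 𝓞 K` over a number field with
  `Δ ≠ 0` and the cruxes' `b3`-binder VERBATIM: `∃ t : K, t ≠ 0 ∧ c₄(E⊗K)³ · t = (t+27)(t+3)³ · Δ(E⊗K)`.

This is exactly the shape in which RECORD v5 (`Theorems/SqrtFiveQuarticCoversRecordWeak5.lean`)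
states its named MODEL inputs (`c₄³ · JDen(u) = JNum(u) · Δ` for `X₀(7)`, `X_ns⁺(5)`, `X(s3)`); the
level-`3` Borel factor is hereby a kernel theorem.  HONEST STATUS: proved, no named fact; a helper of
stmt-Langlands-17833 toward its N1 debt («no modular curves in Mathlib»); it closes no stub and moves no
binder of the record (whose level-`3` inputs are bundled with level `5`/`7` data); nothing here proves
modularity of any curve.

References: M. Deuring, *Die Typen der Multiplikatorenringe elliptischer Funktionenkörper*, Abh. Math.
Sem. Hamburg 14 (1941) (the normal form `y² + a₁xy + a₃y = x³`); J. H. Silverman, *The Arithmetic of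
Elliptic Curves*, GTM 106 (2009), III.§1 (change of variables, `c₄`, `Δ`), Ex. 3.7 (`Ψ₃`);
R. Fricke, *Die elliptischen Funktionen und ihre Anwendungen* II (1922) (`j = (t+27)(t+3)³/t` on
`X₀(3)`); [FreitasLeHungSiksek2015] §2.2.
-/

noncomputable section

set_option linter.dupNamespace false -- project-wide option (lakefile weak.linter.dupNamespace); `Summit.Langlands.Langlands` is the mandated namespace

open scoped Classical
open scoped Matrix NumberField

namespace Summit.Langlands.Langlands.Theorems.SqrtFiveQuarticCovers

open WeierstrassCurve Literature.NumberTheory.GaloisRepresentations Polynomial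

/-- Unfolding `Ψ₃(x) = 3x⁴ + b₂x³ + 3b₄x² + 3b₆x + b₈` at a point. [folklore] -/
theorem eval_Ψ₃_eq {R : Type*} [CommRing R] (W : WeierstrassCurve R) (x : R) :
    W.Ψ₃.eval x = 3 * x ^ 4 + W.b₂ * x ^ 3 + 3 * W.b₄ * x ^ 2 + 3 * W.b₆ * x + W.b₈ := by
  simp only [WeierstrassCurve.Ψ₃, eval_add, eval_mul, eval_C, eval_pow, eval_X, eval_ofNat]

/-- **Flex identity I.**  Over any commutative ring, if `x` is a root of the `3`-division polynomial
`Ψ₃` of `W`, then `Δ(W) = τ³ − 27υ²` with `τ = 6x² + b₂x + b₄`, `υ = 4x³ + b₂x² + 2b₄x + b₆`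
(the discriminant of the Deuring form `y² + A₁xy + A₃y = x³` reached by a `u = 1` isomorphism,
`Δ = A₃³(A₁³ − 27A₃)`, read through `A₁³/A₃ = τ³/υ²`, `A₃⁴ = υ²`).  Proof: an explicit
`ℤ`-combination of `Ψ₃(x) = 0` and the `b`-relation `4b₈ = b₂b₆ − b₄²`.
[cite: SilvermanAEC2009, III.§1 and Ex. 3.7] -/
theorem Δ_eq_of_eval_Ψ₃_eq_zero {R : Type*} [CommRing R] (W : WeierstrassCurve R) {x : R}
    (hx : W.Ψ₃.eval x = 0) :
    W.Δ = (6 * x ^ 2 + W.b₂ * x + W.b₄) ^ 3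
      - 27 * (4 * x ^ 3 + W.b₂ * x ^ 2 + 2 * W.b₄ * x + W.b₆) ^ 2 := by
  rw [eval_Ψ₃_eq] at hx
  have hrel := W.b_relation
  rw [WeierstrassCurve.Δ]
  linear_combination (72 * x ^ 2 + 12 * W.b₂ * x - W.b₂ ^ 2 + 36 * W.b₄) * hx
    + (-18 * x ^ 2 - 3 * W.b₂ * x - 9 * W.b₄) * hrel

/-- **Flex identity II.**  Over any commutative ring, if `Ψ₃(x) = 0` then
`c₄(W) · υ² = τ (τ³ − 24 υ²)` with `τ, υ` as in `Δ_eq_of_eval_Ψ₃_eq_zero` (the invariant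
`c₄ = A₁(A₁³ − 24A₃)` of the Deuring form).  Proof: an explicit `ℤ`-combination of `Ψ₃(x) = 0` and
the `b`-relation. [cite: SilvermanAEC2009, III.§1 and Ex. 3.7] -/
theorem c₄_mul_eq_of_eval_Ψ₃_eq_zero {R : Type*} [CommRing R] (W : WeierstrassCurve R) {x : R}
    (hx : W.Ψ₃.eval x = 0) :
    W.c₄ * (4 * x ^ 3 + W.b₂ * x ^ 2 + 2 * W.b₄ * x + W.b₆) ^ 2 =
      (6 * x ^ 2 + W.b₂ * x + W.b₄) *
        ((6 * x ^ 2 + W.b₂ * x + W.b₄) ^ 3 - 24 * (4 * x ^ 3 + W.b₂ * x ^ 2 + 2 * W.b₄ * x + W.b₆) ^ 2) := by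
  rw [eval_Ψ₃_eq] at hx
  have hrel := W.b_relation
  rw [WeierstrassCurve.c₄]
  linear_combination (336 * x ^ 4 + 112 * W.b₂ * x ^ 3 + 8 * W.b₂ ^ 2 * x ^ 2 + 144 * W.b₄ * x ^ 2
      + 16 * W.b₂ * W.b₄ * x + 48 * W.b₆ * x - 24 * W.b₄ ^ 2 + 32 * W.b₂ * W.b₆ - 112 * W.b₈) * hx
    + (-2 * W.b₂ ^ 2 * x ^ 2 + 48 * W.b₄ * x ^ 2 - 4 * W.b₂ * W.b₄ * x + 72 * W.b₆ * x - W.b₄ ^ 2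
      - W.b₂ * W.b₆ + 28 * W.b₈) * hrel

/-- Over a reduced commutative ring (e.g. a field), a root `x` of `Ψ₃` with `Δ(W) ≠ 0` has
`υ(x) = 4x³ + b₂x² + 2b₄x + b₆ ≠ 0` (i.e. the flex is not a `2`-torsion point): otherwise identity II
gives `τ⁴ = 0`, so `τ = 0`, and identity I gives `Δ = 0`. [cite: SilvermanAEC2009, Ex. 3.7] -/
theorem υ_ne_zero_of_eval_Ψ₃_eq_zero {R : Type*} [CommRing R] [IsReduced R] (W : WeierstrassCurve R)
    {x : R} (hx : W.Ψ₃.eval x = 0) (hΔ : W.Δ ≠ 0) :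
    4 * x ^ 3 + W.b₂ * x ^ 2 + 2 * W.b₄ * x + W.b₆ ≠ 0 := by
  intro h0
  have h1 := Δ_eq_of_eval_Ψ₃_eq_zero W hx
  have h2 := c₄_mul_eq_of_eval_Ψ₃_eq_zero W hx
  rw [h0] at h1 h2
  have hτ4 : (6 * x ^ 2 + W.b₂ * x + W.b₄) ^ 4 = 0 := by linear_combination -h2
  have hτ : 6 * x ^ 2 + W.b₂ * x + W.b₄ = 0 := pow_eq_zero_iff (by norm_num) |>.1 hτ4
  apply hΔ
  rw [h1, hτ]
  ring

/-- Pure field algebra behind the hauptmodul: from `Δ = τ³ − 27υ²`, `c³υ⁶ = τ³(τ³ − 24υ²)³` and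
`υ ≠ 0`, the value `t = Δ/υ²` satisfies `c³ t = (t + 27)(t + 3)³ Δ`. [folklore] -/
theorem hauptmodul_algebra {K : Type*} [Field K] {c Δ τ υ : K} (hυ : υ ≠ 0)
    (h1 : Δ = τ ^ 3 - 27 * υ ^ 2) (key : c ^ 3 * υ ^ 6 = τ ^ 3 * (τ ^ 3 - 24 * υ ^ 2) ^ 3) :
    c ^ 3 * (Δ / υ ^ 2) = (Δ / υ ^ 2 + 27) * (Δ / υ ^ 2 + 3) ^ 3 * Δ := by
  have hυ2 : υ ^ 2 ≠ 0 := pow_ne_zero 2 hυ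
  have e27 : Δ / υ ^ 2 + 27 = τ ^ 3 / υ ^ 2 := by
    rw [h1, eq_div_iff hυ2, add_mul, div_mul_cancel₀ _ hυ2]
    ring
  have e3 : Δ / υ ^ 2 + 3 = (τ ^ 3 - 24 * υ ^ 2) / υ ^ 2 := by
    rw [h1, eq_div_iff hυ2, add_mul, div_mul_cancel₀ _ hυ2]
    ring
  rw [e27, e3, div_pow, div_mul_div_comm, ← key]
  field_simp

/-- **The hauptmodul of `X₀(3)` from a root of `Ψ₃`.**  Over a field, if `Ψ₃(W)(x) = 0` and
`Δ(W) ≠ 0`, then `t := Δ / υ(x)²` satisfies `c₄³ · t = (t + 27)(t + 3)³ · Δ` — i.e.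
`j(W) = (t+27)(t+3)³/t`, the classical uniformisation of `X₀(3) → X(1)` (Fricke), `t + 27 = τ³/υ²`
being the Deuring/`X₁(3)` coordinate `A₁³/A₃`.  Proof: identities I and II.
[cite: SilvermanAEC2009, III.§1, Ex. 3.7] -/
theorem exists_X0_three_hauptmodul_of_eval_Ψ₃_eq_zero {K : Type*} [Field K] (W : WeierstrassCurve K)
    {x : K} (hx : W.Ψ₃.eval x = 0) (hΔ : W.Δ ≠ 0) :
    ∃ t : K, W.c₄ ^ 3 * t = (t + 27) * (t + 3) ^ 3 * W.Δ := by
  have h1 := Δ_eq_of_eval_Ψ₃_eq_zero W hx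
  have h2 := c₄_mul_eq_of_eval_Ψ₃_eq_zero W hx
  have hυ := υ_ne_zero_of_eval_Ψ₃_eq_zero W hx hΔ
  have key : W.c₄ ^ 3 * (4 * x ^ 3 + W.b₂ * x ^ 2 + 2 * W.b₄ * x + W.b₆) ^ 6 =
      (6 * x ^ 2 + W.b₂ * x + W.b₄) ^ 3 * ((6 * x ^ 2 + W.b₂ * x + W.b₄) ^ 3
        - 24 * (4 * x ^ 3 + W.b₂ * x ^ 2 + 2 * W.b₄ * x + W.b₆) ^ 2) ^ 3 := by
    calc W.c₄ ^ 3 * (4 * x ^ 3 + W.b₂ * x ^ 2 + 2 * W.b₄ * x + W.b₆) ^ 6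
        = (W.c₄ * (4 * x ^ 3 + W.b₂ * x ^ 2 + 2 * W.b₄ * x + W.b₆) ^ 2) ^ 3 := by ring
      _ = ((6 * x ^ 2 + W.b₂ * x + W.b₄) * ((6 * x ^ 2 + W.b₂ * x + W.b₄) ^ 3
            - 24 * (4 * x ^ 3 + W.b₂ * x ^ 2 + 2 * W.b₄ * x + W.b₆) ^ 2)) ^ 3 := by rw [h2]
      _ = _ := by ring
  exact ⟨_, hauptmodul_algebra hυ h1 key⟩

/-- **Moduli interpretation of `X₀(3)` for the route's framed curves.**  For a number field `K`,
`E / 𝓞 K` with `Δ(E) ≠ 0`, and the `b3`-binder of the route's cruxes VERBATIM (a framing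
`ρ̄ : Γ_K →ₜ* GL₂(𝔽₃)` of `E[3]` — `WeierstrassCurve.IsTorsionGaloisRep 3 ρ̄` written out — with every
`(1,0)` entry zero), there is `t ∈ K`, `t ≠ 0`, with `c₄(E⊗K)³ · t = (t + 27)(t + 3)³ · Δ(E⊗K)`, i.e.
`j(E) = (t+27)(t+3)³/t` is the image of a `K`-point of `X₀(3)` — the statement «`E` has a `K`-rational
`3`-isogeny ⇒ `[E] ∈ j(X₀(3)(K))`» in the exact shape of RECORD v5's MODEL binders.  Proof:
`exists_eval_Ψ₃_eq_zero_of_borelThree_framing` (p798920) and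
`exists_X0_three_hauptmodul_of_eval_Ψ₃_eq_zero`; `t ≠ 0` since `t = 0` forces `729 Δ = 0`.
[cite: SilvermanAEC2009, III.§7, Ex. 3.7] [cite: FreitasLeHungSiksek2015, §2.2, §5.2] -/
theorem exists_X0_three_hauptmodul_of_borelThree_framing (K : Type) [Field K] [NumberField K]
    (E : WeierstrassCurve (𝓞 K)) (hE : E.Δ ≠ 0)
    (h3 : ∃ ρ : Literature.NumberTheory.GaloisRepresentations.FramedGaloisRep K (ZMod 3) 2,
      (∃ e : (E.baseChange K).geomTorsion ((3 : ℕ) : ℤ) ≃+ (Fin 2 → ZMod 3),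
        ∀ (σ : Field.absoluteGaloisGroup K) (P : (E.baseChange K).geomTorsion ((3 : ℕ) : ℤ)),
          e (σ • P) = ((ρ σ : GL (Fin 2) (ZMod 3)) : Matrix (Fin 2) (Fin 2) (ZMod 3)) *ᵥ (e P)) ∧
      (∀ σ : Field.absoluteGaloisGroup K,
        (((ρ σ : GL (Fin 2) (ZMod 3)) : Matrix (Fin 2) (Fin 2) (ZMod 3)) 1 0 = 0))) :
    ∃ t : K, t ≠ 0 ∧ (E.baseChange K).c₄ ^ 3 * t = (t + 27) * (t + 3) ^ 3 * (E.baseChange K).Δ := by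
  obtain ⟨x₀, hx₀⟩ := exists_eval_Ψ₃_eq_zero_of_borelThree_framing K E h3
  have hΔK : (E.baseChange K).Δ ≠ 0 := by
    rw [WeierstrassCurve.baseChange, WeierstrassCurve.map_Δ]
    exact (map_ne_zero_iff _ (FaithfulSMul.algebraMap_injective (𝓞 K) K)).2 hE
  obtain ⟨t, ht⟩ := exists_X0_three_hauptmodul_of_eval_Ψ₃_eq_zero (E.baseChange K) hx₀ hΔK
  refine ⟨t, ?_, ht⟩
  rintro rfl
  apply hΔK
  have h729 : (729 : K) * (E.baseChange K).Δ = 0 := by linear_combination -ht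
  exact (mul_eq_zero.1 h729).resolve_left (by norm_num)

end Summit.Langlands.Langlands.Theorems.SqrtFiveQuarticCovers

end
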